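import Literature.NumberTheory.PAdicHodge.PadicFieldSpectralNorm
import Literature.IUT.LogVolume.UnitLogKernel
import HarnessLib

/-!
# `ℂ_F` as a complete normed `ℚ_p`-algebra (`ℚ_p`-normalised absolute value) and the `p`-adic logarithm on `1 + 𝔪_{ℂ_F}`:
# its kernel is `μ_{p^∞}`, it is a homomorphism, and it is surjective near `0`

Topic `Literature/NumberTheory/PAdicHodge`; namespace `Literature.NumberTheory.PAdicHodge`. Sequel of `PadicFieldSpectralNorm` (the
valuation-side `p`-adic field `F` as a normed `ℚ_p`-algebra; `‖·‖_val = ‖·‖^s` on `F`, ONE exponent `s > 0`). The tree's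
`ℂ_F = CompletedAlgClosure F` carries the completion of the valuation norm of `F̄` (`algNorm F`), whose restriction to `ℚ_p` is `|·|_p^s` — so
`ℂ_F` is NOT a `NormedAlgebra ℚ_[p]`, and the abc-iut cell's `p`-adic analysis (`IUT/LogVolume/*`: `logSeries`, `logSeries_injOn`,
`exists_logSeries_eq`, `exists_norm_one_sub_pow_le`, …, all over `[NormedAlgebra ℚ_[p] K] [IsUltrametricDist K] [CompleteSpace K]`) does not
apply to it verbatim. This file supplies the rescaling and reads the results back on `ℂ_F` in NORM-FREE form:

* §1 `PadicField.normExponent F p hp` (the `s`), `PadicCompletedAlgClosure F p hp` — a TYPE SYNONYM of `ℂ_F` with the absolute value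
  `‖x‖' = ‖x‖_{ℂ_F}^{1/s}` (`absVal`; a `NormedField` whose uniform structure IS that of `ℂ_F`, Mathlib `replaceUniformity` pattern), instances
  `CompleteSpace`, `IsUltrametricDist`, `Algebra ℚ_[p]` (`ℚ_p → F → ℂ_F`, canonical), ★ `NormedAlgebra ℚ_[p]` (`‖ι q‖' = |q|_p`),
  `NontriviallyNormedField`; `norm_def`, `norm_lt_one_iff` / `_le_` / `_eq_` (unit balls agree with `ℂ_F`'s).
* §2 consequences on `ℂ_F` itself, stated with `HasSum` for ITS topology and `‖·‖_{ℂ_F} < 1` only: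
  ★★ `CompletedAlgClosure.exists_pow_prime_pow_eq_one_of_hasSum_log_zero` — **if `‖1 − x‖ < 1` and `Σ_{n≥1} −(1−x)ⁿ/n = 0` in `ℂ_F` then
  `x^{p^N} = 1` for some `N`** (the kernel of `log` on `1 + 𝔪_ℂ` is `μ_{p^∞}`: IUT `exists_norm_one_sub_pow_le` + `logSeries_pow` + `logSeries_injOn`);
  ★ `CompletedAlgClosure.hasSum_log_mul` (`log(xy) = log x + log y` on `1 + 𝔪_ℂ`, IUT `logSeries_mul`); ★ `CompletedAlgClosure.exists_hasSum_log_eq_of_norm_le`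
  — **`log` is surjective near `0`**: one radius `r > 0` such that every `z`, `‖z‖ ≤ r`, is `log u` with `‖1 − u‖ < 1` (IUT `exists_logSeries_eq`).

Use (line `kato_lever` of crux K★ `stmt-BirchSwinnertonDyer-22226`, the LEAD's (H4) step (2) `X₂ ∩ ℂ_F(1) = ℚ_p(1)` / `θ(X₂) = ℂ_F` for
`X₂ = ℚ_p · log[1+𝔪♭] ⊂ B_dR⁺/Fil²`: `θ(log[x]) = log(x♯)`, so `log(x♯) = 0 ⇒ (x^{p^N})♯ = 1 ⇒ x^{p^N} = ε^a ⇒ log[x] ∈ ℚ_p t`, and every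
`z ∈ ℂ_F` is `p^{-N} log(u)`). Infrastructure only; BSD / K★ / [REC] are NOT proved by any of this.

## References
* J. Neukirch, *Algebraic Number Theory* (1999), Ch. II (3.3), (4.8), (5.4)–(5.5). [NeukirchANT1999]
* N. Koblitz, *p-adic Numbers, p-adic Analysis, and Zeta-Functions* (1984), Ch. IV §1–2. [Koblitz1984]
* J.-M. Fontaine, *Le corps des périodes p-adiques*, Astérisque 223 (1994), Exp. II §1.5.4. [FontaineAsterisque223III]
-/

noncomputable section

open ValuativeRel Field Filter Topology Uniformity

namespace Literature.NumberTheory.PAdicHodge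

open Literature.NumberTheory.GaloisRepresentations
open Literature.NumberTheory.GaloisRepresentations.IsNonarchimedeanLocalField
open Literature.IUT.LogVolume

variable (F : Type) [Field F] [ValuativeRel F] [TopologicalSpace F] [IsNonarchimedeanLocalField F] [CharZero F]
  (p : ℕ) [hprime : Fact p.Prime] (hp : valuation F p < 1)

/-! ## §1 The exponent and the synonym -/

namespace PadicField

/-- **The exponent `s > 0` with `‖·‖_val = ‖·‖^s on `F`** (`PadicField.exists_rpow_norm_eq_norm`), chosen once.
[cite: NeukirchANT1999, Ch. II (3.3)] -/
def normExponent : ℝ := Classical.choose (exists_rpow_norm_eq_norm F p hp)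

/-- `0 < s`. [cite: NeukirchANT1999, Ch. II (3.3)] -/
theorem normExponent_pos : 0 < normExponent F p hp := (Classical.choose_spec (exists_rpow_norm_eq_norm F p hp)).1

/-- `‖x‖_val = ‖x‖ ^ s` on `F`. [cite: NeukirchANT1999, Ch. II (3.3)] -/
theorem norm_val_eq_norm_rpow_normExponent (x : F) :
    (letI := nontriviallyNormedField F; ‖x‖) = (@Norm.norm F (normedField F p hp).toNorm x) ^ normExponent F p hp :=
  (Classical.choose_spec (exists_rpow_norm_eq_norm F p hp)).2 x

end PadicField

/-- **`ℂ_F` with the `ℚ_p`-normalised absolute value**: a type synonym of `CompletedAlgClosure F` which will carry the norm `‖x‖_{ℂ_F}^{1/s}`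
(`s = PadicField.normExponent F p hp`) and the SAME uniform structure. [cite: NeukirchANT1999, Ch. II (4.8)] -/
@[nolint unusedArguments]
def PadicCompletedAlgClosure (_hp : valuation F p < 1) : Type := CompletedAlgClosure F

namespace PadicCompletedAlgClosure

variable {F p}

/-- Field structure (that of `ℂ_F`). [folklore] -/
instance instField : Field (PadicCompletedAlgClosure F p hp) := inferInstanceAs (Field (CompletedAlgClosure F))

/-- Characteristic `0` (it contains `F`). [folklore] -/
instance instCharZero : CharZero (PadicCompletedAlgClosure F p hp) :=
  haveI : CharZero (CompletedAlgClosure F) := charZero_of_injective_algebraMap (algebraMap F (CompletedAlgClosure F)).injective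
  inferInstanceAs (CharZero (CompletedAlgClosure F))

/-- The identification with `ℂ_F` (the identity). [folklore] -/
def toC : PadicCompletedAlgClosure F p hp ≃+* CompletedAlgClosure F := RingEquiv.refl _

/-- **The rescaled absolute value `‖x‖_{ℂ_F}^{1/s}`** (a positive power of a non-archimedean absolute value is an absolute value).
[cite: NeukirchANT1999, Ch. II (3.3)] -/
def absVal : AbsoluteValue (PadicCompletedAlgClosure F p hp) ℝ where
  toFun x := ‖toC hp x‖ ^ (PadicField.normExponent F p hp)⁻¹
  map_mul' x y := by
    rw [map_mul, norm_mul]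
    exact Real.mul_rpow (norm_nonneg _) (norm_nonneg _)
  nonneg' x := Real.rpow_nonneg (norm_nonneg _) _
  eq_zero' x := by
    change ‖toC hp x‖ ^ _ = 0 ↔ x = 0
    rw [Real.rpow_eq_zero (norm_nonneg _) (inv_ne_zero (PadicField.normExponent_pos F p hp).ne'), norm_eq_zero,
      map_eq_zero_iff _ (toC hp).injective]
  add_le' x y := by
    rw [map_add]
    have hs := PadicField.normExponent_pos F p hp
    have hmax : ‖toC hp x + toC hp y‖ ^ (PadicField.normExponent F p hp)⁻¹ ≤
        (max ‖toC hp x‖ ‖toC hp y‖) ^ (PadicField.normExponent F p hp)⁻¹ :=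
      Real.rpow_le_rpow (norm_nonneg _) (IsUltrametricDist.norm_add_le_max _ _) (inv_pos.2 hs).le
    refine hmax.trans ?_
    rcases le_total ‖toC hp x‖ ‖toC hp y‖ with h | h
    · rw [max_eq_right h]; exact le_add_of_nonneg_left (Real.rpow_nonneg (norm_nonneg _) _)
    · rw [max_eq_left h]; exact le_add_of_nonneg_right (Real.rpow_nonneg (norm_nonneg _) _)

/-- Unfolding `absVal`. [cite: NeukirchANT1999, Ch. II (3.3)] -/
theorem absVal_apply (x : PadicCompletedAlgClosure F p hp) :
    absVal hp x = ‖toC hp x‖ ^ (PadicField.normExponent F p hp)⁻¹ := rfl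

/-- The rescaled balls are cofinal with the old ones: the metric uniformity of `absVal` IS the uniformity of `ℂ_F`.
[cite: NeukirchANT1999, Ch. II (3.3)] -/
theorem uniformity_eq_absVal :
    𝓤[(inferInstance : UniformSpace (CompletedAlgClosure F))] =
      𝓤[((absVal hp).toNormedField).toMetricSpace.toPseudoMetricSpace.toUniformSpace] := by
  have hs := PadicField.normExponent_pos F p hp
  have h₁ := @Metric.uniformity_basis_dist (CompletedAlgClosure F) _
  have h₂ := @Metric.uniformity_basis_dist (PadicCompletedAlgClosure F p hp) ((absVal hp).toNormedField).toMetricSpace.toPseudoMetricSpace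
  have hd : ∀ x y : PadicCompletedAlgClosure F p hp,
      @Dist.dist _ ((absVal hp).toNormedField).toMetricSpace.toPseudoMetricSpace.toDist x y =
        ‖toC hp x - toC hp y‖ ^ (PadicField.normExponent F p hp)⁻¹ := fun x y => by
    change absVal hp (-x + y) = _
    rw [absVal_apply, map_add, map_neg, neg_add_eq_sub, norm_sub_rev]
  refine h₁.ext h₂ (fun ε hε => ⟨ε ^ (PadicField.normExponent F p hp)⁻¹, Real.rpow_pos_of_pos hε _, fun q hq => ?_⟩)
    (fun ε hε => ⟨ε ^ PadicField.normExponent F p hp, Real.rpow_pos_of_pos hε _, fun q hq => ?_⟩)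
  · -- `dist' < ε ^ (1/s) → dist < ε`
    obtain ⟨a, b⟩ := q
    have hq' : @Dist.dist _ ((absVal hp).toNormedField).toMetricSpace.toPseudoMetricSpace.toDist a b <
        ε ^ (PadicField.normExponent F p hp)⁻¹ := hq
    show @Dist.dist (CompletedAlgClosure F) _ a b < ε
    rw [hd] at hq'
    rw [dist_eq_norm]
    exact (Real.rpow_lt_rpow_iff (norm_nonneg _) hε.le (inv_pos.2 hs)).1 hq'
  · -- `dist < ε ^ s → dist' < ε`
    obtain ⟨a, b⟩ := q
    have hq' : @Dist.dist (CompletedAlgClosure F) _ a b < ε ^ PadicField.normExponent F p hp := hq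
    show @Dist.dist _ ((absVal hp).toNormedField).toMetricSpace.toPseudoMetricSpace.toDist a b < ε
    rw [dist_eq_norm] at hq'
    rw [hd, ← Real.rpow_lt_rpow_iff (Real.rpow_nonneg (norm_nonneg _) _) hε.le hs,
      Real.rpow_inv_rpow (norm_nonneg _) hs.ne']
    exact hq'

/-- The normed field structure: norm `‖x‖_{ℂ_F}^{1/s}`, uniform structure that of `ℂ_F` (so completeness, the topology and every `HasSum`
statement are shared with `ℂ_F`). Auxiliary: the instance is `instNontriviallyNormedField`. [cite: NeukirchANT1999, Ch. II (3.3), (4.8)] -/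
@[reducible] def normedFieldAux : NormedField (PadicCompletedAlgClosure F p hp) :=
  { (absVal hp).toNormedField with
    toUniformSpace := (inferInstance : UniformSpace (CompletedAlgClosure F))
    uniformity_dist := (uniformity_eq_absVal hp).trans (@PseudoMetricSpace.uniformity_dist _
      ((absVal hp).toNormedField).toMetricSpace.toPseudoMetricSpace) }

/-- **`ℂ_F` with the `ℚ_p`-normalised absolute value is a nontrivially normed field** (`‖p‖ = ‖p‖_{ℂ_F}^{1/s} < 1`); its uniform structure
IS that of `ℂ_F`. [cite: NeukirchANT1999, Ch. II (3.3), (4.8)] -/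
instance instNontriviallyNormedField : NontriviallyNormedField (PadicCompletedAlgClosure F p hp) :=
  letI := normedFieldAux hp
  NontriviallyNormedField.ofNormNeOne ⟨(p : PadicCompletedAlgClosure F p hp), Nat.cast_ne_zero.2 hprime.out.ne_zero, by
    have h : ‖(p : PadicCompletedAlgClosure F p hp)‖ = ‖(p : CompletedAlgClosure F)‖ ^ (PadicField.normExponent F p hp)⁻¹ := rfl
    rw [h]
    have hlt : ‖(p : CompletedAlgClosure F)‖ < 1 := by
      rw [← map_natCast (algebraMap F (CompletedAlgClosure F)), CompletedAlgClosure.norm_algebraMap]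
      exact (IsNonarchimedeanLocalField.norm_lt_one_iff F _).2 hp
    exact (Real.rpow_lt_one (norm_nonneg _) hlt (inv_pos.2 (PadicField.normExponent_pos F p hp))).ne⟩

/-- `‖x‖ = ‖x‖_{ℂ_F} ^ (1/s)`. [cite: NeukirchANT1999, Ch. II (3.3)] -/
theorem norm_def (x : PadicCompletedAlgClosure F p hp) : ‖x‖ = ‖toC hp x‖ ^ (PadicField.normExponent F p hp)⁻¹ := rfl

/-- `‖x‖ ^ s = ‖x‖_{ℂ_F}`. [cite: NeukirchANT1999, Ch. II (3.3)] -/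
theorem norm_rpow_normExponent (x : PadicCompletedAlgClosure F p hp) : ‖x‖ ^ PadicField.normExponent F p hp = ‖toC hp x‖ := by
  rw [norm_def, Real.rpow_inv_rpow (norm_nonneg _) (PadicField.normExponent_pos F p hp).ne']

/-- `‖x‖ < 1 ↔ ‖x‖_{ℂ_F} < 1`. [cite: NeukirchANT1999, Ch. II (3.3)] -/
theorem norm_lt_one_iff (x : PadicCompletedAlgClosure F p hp) : ‖x‖ < 1 ↔ ‖toC hp x‖ < 1 := by
  rw [← norm_rpow_normExponent hp x, ← Real.rpow_lt_rpow_iff (norm_nonneg _) zero_le_one (PadicField.normExponent_pos F p hp),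
    Real.one_rpow]

/-- `‖x‖ ≤ 1 ↔ ‖x‖_{ℂ_F} ≤ 1`. [cite: NeukirchANT1999, Ch. II (3.3)] -/
theorem norm_le_one_iff (x : PadicCompletedAlgClosure F p hp) : ‖x‖ ≤ 1 ↔ ‖toC hp x‖ ≤ 1 := by
  rw [← norm_rpow_normExponent hp x, ← Real.rpow_le_rpow_iff (norm_nonneg _) zero_le_one (PadicField.normExponent_pos F p hp),
    Real.one_rpow]

/-- `‖x‖ ≤ r ↔ ‖x‖_{ℂ_F} ≤ r ^ s` (`0 ≤ r`). [cite: NeukirchANT1999, Ch. II (3.3)] -/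
theorem norm_le_iff {r : ℝ} (hr : 0 ≤ r) (x : PadicCompletedAlgClosure F p hp) :
    ‖x‖ ≤ r ↔ ‖toC hp x‖ ≤ r ^ PadicField.normExponent F p hp := by
  rw [← norm_rpow_normExponent hp x, Real.rpow_le_rpow_iff (norm_nonneg _) hr (PadicField.normExponent_pos F p hp)]

/-- `ℂ_F` is complete for the rescaled norm (same uniformity). [folklore] -/
instance instCompleteSpace : CompleteSpace (PadicCompletedAlgClosure F p hp) :=
  inferInstanceAs (CompleteSpace (CompletedAlgClosure F))

/-- The rescaled norm is ultrametric. [cite: NeukirchANT1999, Ch. II (3.3)] -/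
instance instIsUltrametricDist : IsUltrametricDist (PadicCompletedAlgClosure F p hp) := by
  refine IsUltrametricDist.isUltrametricDist_of_forall_norm_add_le_max_norm fun x y => ?_
  rw [norm_def, norm_def, norm_def, map_add]
  have hs := PadicField.normExponent_pos F p hp
  refine (Real.rpow_le_rpow (norm_nonneg _) (IsUltrametricDist.norm_add_le_max _ _) (inv_pos.2 hs).le).trans ?_
  rcases le_total ‖toC hp x‖ ‖toC hp y‖ with h | h
  · rw [max_eq_right h]; exact le_max_right _ _
  · rw [max_eq_left h]; exact le_max_left _ _

/-- `ℂ_F` as a `ℚ_p`-algebra: `ℚ_p → F → ℂ_F` (canonical `LocalField.padicAlgebra`, then `algebraMap F ℂ_F`). [folklore] -/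
instance instAlgebraPadic : Algebra ℚ_[p] (PadicCompletedAlgClosure F p hp) :=
  ((algebraMap F (CompletedAlgClosure F)).comp (LocalField.padicRingHom F p hp)).toAlgebra

/-- Unfolding the `ℚ_p`-algebra map: `ℚ_p → F → ℂ_F`. [cite: NeukirchANT1999, Ch. II (5.2)] -/
theorem algebraMap_padic_apply (q : ℚ_[p]) :
    toC hp (algebraMap ℚ_[p] (PadicCompletedAlgClosure F p hp) q) =
      algebraMap F (CompletedAlgClosure F) (LocalField.padicRingHom F p hp q) := rfl

/-- **`‖ι q‖ = |q|_p`**: the rescaled norm extends the `p`-adic absolute value (`‖ι_F q‖_{ℂ} = ‖ι_F q‖_val = (‖q‖_p)^s`).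
[cite: NeukirchANT1999, Ch. II (4.8)] -/
theorem norm_algebraMap_padic (q : ℚ_[p]) : ‖algebraMap ℚ_[p] (PadicCompletedAlgClosure F p hp) q‖ = ‖q‖ := by
  have hn : 0 ≤ @Norm.norm F (PadicField.normedField F p hp).toNorm (LocalField.padicRingHom F p hp q) := by
    letI := PadicField.normedField F p hp; exact norm_nonneg _
  have hq : @Norm.norm F (PadicField.normedField F p hp).toNorm (LocalField.padicRingHom F p hp q) = ‖q‖ := by
    letI := LocalField.padicAlgebra F p hp
    exact PadicField.norm_algebraMap F p hp q
  rw [norm_def, algebraMap_padic_apply, CompletedAlgClosure.norm_algebraMap, PadicField.norm_val_eq_norm_rpow_normExponent F p hp,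
    Real.rpow_rpow_inv hn (PadicField.normExponent_pos F p hp).ne', hq]

/-- ★ **`ℂ_F` (rescaled) is a normed `ℚ_p`-algebra** — the instance package of `IUT/LogVolume`. [cite: NeukirchANT1999, Ch. II (4.8)] -/
instance instNormedAlgebra : NormedAlgebra ℚ_[p] (PadicCompletedAlgClosure F p hp) where
  norm_smul_le q x := by rw [Algebra.smul_def, norm_mul, norm_algebraMap_padic]

/-- `HasSum` statements on the synonym ARE `HasSum` statements on `ℂ_F` (same additive group, same topology). [cite: NeukirchANT1999, Ch. II (3.3)] -/
theorem hasSum_iff {f : ℕ → CompletedAlgClosure F} {a : CompletedAlgClosure F} :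
    HasSum (fun n => (toC hp).symm (f n)) ((toC hp).symm a) ↔ HasSum f a := Iff.rfl

end PadicCompletedAlgClosure

/-! ## §2 The logarithm on `1 + 𝔪_{ℂ_F}`: kernel, functional equation, surjectivity near `0` -/

namespace CompletedAlgClosure

variable {F p}

/-- The logarithm series of `x ∈ ℂ_F` read on the synonym. [folklore] -/
private theorem hasSum_log_transport (hp : valuation F p < 1) {x a : CompletedAlgClosure F}
    (h : HasSum (fun n : ℕ => -((1 - x) ^ (n + 1)) / (n + 1 : CompletedAlgClosure F)) a) :
    HasSum (fun n : ℕ => -((1 - (PadicCompletedAlgClosure.toC hp).symm x) ^ (n + 1)) / (n + 1 : PadicCompletedAlgClosure F p hp))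
      ((PadicCompletedAlgClosure.toC hp).symm a) :=
  (PadicCompletedAlgClosure.hasSum_iff hp).2 h

/-- And back. [folklore] -/
private theorem hasSum_log_transport' (hp : valuation F p < 1) {y a : PadicCompletedAlgClosure F p hp}
    (h : HasSum (fun n : ℕ => -((1 - y) ^ (n + 1)) / (n + 1 : PadicCompletedAlgClosure F p hp)) a) :
    HasSum (fun n : ℕ => -((1 - PadicCompletedAlgClosure.toC hp y) ^ (n + 1)) / (n + 1 : CompletedAlgClosure F))
      (PadicCompletedAlgClosure.toC hp a) :=
  (PadicCompletedAlgClosure.hasSum_iff hp).1 h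

/-- ★★ **The kernel of `log` on `1 + 𝔪_{ℂ_F}` is `μ_{p^∞}`**: if `‖1 − x‖ < 1` and the logarithm series `Σ_{n≥1} −(1−x)ⁿ/n` sums to `0` in
`ℂ_F`, then `x^{p^N} = 1` for some `N` (`x^{p^N} → 1` enters the ball where the series is injective, IUT `exists_norm_one_sub_pow_le`,
`logSeries_pow`, `logSeries_injOn`, read through the rescaled norm). [cite: Koblitz1984, Ch. IV §2] [cite: NeukirchANT1999, Ch. II (5.5)] -/
theorem exists_pow_prime_pow_eq_one_of_hasSum_log_zero (hp : valuation F p < 1) {x : CompletedAlgClosure F} (hx : ‖1 - x‖ < 1)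
    (h0 : HasSum (fun n : ℕ => -((1 - x) ^ (n + 1)) / (n + 1 : CompletedAlgClosure F)) 0) : ∃ N : ℕ, x ^ (p ^ N) = 1 := by
  let y : PadicCompletedAlgClosure F p hp := (PadicCompletedAlgClosure.toC hp).symm x
  have hy : ‖1 - y‖ < 1 := by
    rw [PadicCompletedAlgClosure.norm_lt_one_iff, map_sub, map_one]; exact hx
  have hL : logSeries y = 0 := by
    have h := (hasSum_log_transport hp h0).tsum_eq
    rwa [map_zero] at h
  have hprime' : p.Prime := hprime.out
  have hp1 : (1 : ℝ) < p := by exact_mod_cast hprime'.one_lt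
  have hp0 : (0 : ℝ) < p := by linarith
  set ρ : ℝ := (p : ℝ) ^ (-(2 : ℝ)) with hρ
  have hθ : ρ * (p : ℝ) ^ (1 / ((p : ℝ) - 1)) < 1 := by
    rw [hρ, ← Real.rpow_add hp0]
    refine Real.rpow_lt_one_of_one_lt_of_neg hp1 ?_
    have h2 : (2 : ℝ) ≤ p := by exact_mod_cast hprime'.two_le
    have : 1 / ((p : ℝ) - 1) ≤ 1 := by rw [div_le_one (by linarith)]; linarith
    linarith
  have hρ0 : 0 < ρ := Real.rpow_pos_of_pos hp0 _
  obtain ⟨N, hN⟩ := exists_norm_one_sub_pow_le p (PadicCompletedAlgClosure F p hp) hy hρ0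
  have hLN : logSeries (y ^ (p ^ N)) = logSeries (1 : PadicCompletedAlgClosure F p hp) := by
    rw [logSeries_pow p hy, hL, mul_zero, logSeries_one]
  have hmem1 : (1 : PadicCompletedAlgClosure F p hp) ∈ {y : PadicCompletedAlgClosure F p hp | ‖1 - y‖ ≤ ρ} := by simp [hρ0.le]
  have heq := logSeries_injOn p (PadicCompletedAlgClosure F p hp) hθ hN hmem1 hLN
  exact ⟨N, heq⟩

/-- ★ **`log(xy) = log x + log y` on `1 + 𝔪_{ℂ_F}`** (as `HasSum` identities in `ℂ_F`; IUT `logSeries_mul` through the rescaled norm).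
[cite: NeukirchANT1999, Ch. II (5.4)] -/
theorem hasSum_log_mul (hp : valuation F p < 1) {x y : CompletedAlgClosure F} (hx : ‖1 - x‖ < 1) (hy : ‖1 - y‖ < 1) {a b : CompletedAlgClosure F}
    (ha : HasSum (fun n : ℕ => -((1 - x) ^ (n + 1)) / (n + 1 : CompletedAlgClosure F)) a)
    (hb : HasSum (fun n : ℕ => -((1 - y) ^ (n + 1)) / (n + 1 : CompletedAlgClosure F)) b) :
    HasSum (fun n : ℕ => -((1 - x * y) ^ (n + 1)) / (n + 1 : CompletedAlgClosure F)) (a + b) := by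
  let x' : PadicCompletedAlgClosure F p hp := (PadicCompletedAlgClosure.toC hp).symm x
  let y' : PadicCompletedAlgClosure F p hp := (PadicCompletedAlgClosure.toC hp).symm y
  have hx' : ‖1 - x'‖ < 1 := by rw [PadicCompletedAlgClosure.norm_lt_one_iff, map_sub, map_one]; exact hx
  have hy' : ‖1 - y'‖ < 1 := by rw [PadicCompletedAlgClosure.norm_lt_one_iff, map_sub, map_one]; exact hy
  have hxy' : ‖1 - x' * y'‖ < 1 := IsPrincipal.mul hx' hy'
  have hsum : HasSum (fun n : ℕ => -((1 - x' * y') ^ (n + 1)) / (n + 1 : PadicCompletedAlgClosure F p hp)) (logSeries (x' * y')) :=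
    hasSum_logSeries p hxy'
  have ha' : logSeries x' = (PadicCompletedAlgClosure.toC hp).symm a := (hasSum_log_transport hp ha).tsum_eq
  have hb' : logSeries y' = (PadicCompletedAlgClosure.toC hp).symm b := (hasSum_log_transport hp hb).tsum_eq
  rw [logSeries_mul p hx' hy', ha', hb', ← map_add] at hsum
  exact hasSum_log_transport' hp hsum

/-- ★ **`log` is surjective near `0` on `ℂ_F`**: there is `r > 0` such that every `z ∈ ℂ_F` with `‖z‖ ≤ r` is the sum of the logarithm series
of some `u` with `‖1 − u‖ < 1` (IUT `exists_logSeries_eq` — successive approximation, no exponential — through the rescaled norm; `r = ρ^s`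
with `ρ = p^{-2}`). [cite: Koblitz1984, Ch. IV §2] -/
theorem exists_hasSum_log_eq_of_norm_le (hp : valuation F p < 1) :
    ∃ r : ℝ, 0 < r ∧ ∀ z : CompletedAlgClosure F, ‖z‖ ≤ r →
      ∃ u : CompletedAlgClosure F, ‖1 - u‖ < 1 ∧ HasSum (fun n : ℕ => -((1 - u) ^ (n + 1)) / (n + 1 : CompletedAlgClosure F)) z := by
  have hprime' : p.Prime := hprime.out
  have hp1 : (1 : ℝ) < p := by exact_mod_cast hprime'.one_lt
  have hp0 : (0 : ℝ) < p := by linarith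
  set ρ : ℝ := (p : ℝ) ^ (-(2 : ℝ)) with hρ
  have hθ : ρ * (p : ℝ) ^ (1 / ((p : ℝ) - 1)) < 1 := by
    rw [hρ, ← Real.rpow_add hp0]
    refine Real.rpow_lt_one_of_one_lt_of_neg hp1 ?_
    have h2 : (2 : ℝ) ≤ p := by exact_mod_cast hprime'.two_le
    have : 1 / ((p : ℝ) - 1) ≤ 1 := by rw [div_le_one (by linarith)]; linarith
    linarith
  have hρ0 : 0 < ρ := Real.rpow_pos_of_pos hp0 _
  have hρ1 : ρ < 1 := by
    have hq1 : 1 < (p : ℝ) ^ (1 / ((p : ℝ) - 1)) := Real.one_lt_rpow hp1 (div_pos one_pos (by linarith))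
    have : ρ ≤ ρ * (p : ℝ) ^ (1 / ((p : ℝ) - 1)) := by
      calc ρ = ρ * 1 := (mul_one ρ).symm
        _ ≤ _ := by gcongr
    exact this.trans_lt hθ
  refine ⟨ρ ^ PadicField.normExponent F p hp, Real.rpow_pos_of_pos hρ0 _, fun z hz => ?_⟩
  let z' : PadicCompletedAlgClosure F p hp := (PadicCompletedAlgClosure.toC hp).symm z
  have hz' : ‖z'‖ ≤ ρ := (PadicCompletedAlgClosure.norm_le_iff hp hρ0.le z').2 hz
  obtain ⟨u, hu, hLu⟩ := exists_logSeries_eq p (PadicCompletedAlgClosure F p hp) hθ hz'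
  have huP : ‖1 - u‖ < 1 := hu.trans_lt hρ1
  refine ⟨PadicCompletedAlgClosure.toC hp u, ?_, ?_⟩
  · have := (PadicCompletedAlgClosure.norm_lt_one_iff hp (1 - u)).1 huP
    rwa [map_sub, map_one] at this
  · have hsum := hasSum_logSeries p huP
    rw [hLu] at hsum
    exact hasSum_log_transport' hp hsum

end CompletedAlgClosure

end Literature.NumberTheory.PAdicHodge

end
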